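import Summits.SmoothPoincare4.SmoothPoincare4.Theses.VerlindeRLinks
import Summits.SmoothPoincare4.SmoothPoincare4.Theorems.VerlindeRLinksVrlComponentsHBallSliceStubCoreSliceDiscAux1
import Summits.SmoothPoincare4.SmoothPoincare4.Theorems.VerlindeRLinksVrlComponentsHBallSliceStubCoreSliceDiscAux2

/-!
# Line `kirby-lemma21`, Stub 4 (`stub_core_isSliceDiscIn_of_isMultiAttachment`): in
# `D⁴ ∪_L (2-handles)` every component bounds the core of its `2`-handle, off a shrunken `0`-handle
(crux `VerlindeRLinks.VrlComponentsHBallSlice`, item stmt-SmoothPoincare4-15874)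

This file proves the registered stub `stub_core_isSliceDiscIn_of_isMultiAttachment` (signature
verbatim from the lead's skeleton of line `kirby-lemma21`).  Let `2`-handles be attached to `D⁴`
(Kosinski's corner-free attachment, `HandleAttachingMap.IsMultiAttachment g (𝓡∂ 4) P`: smooth open
embeddings `jA : D⁴ ∖ ⋃ cores ↪ P`, `jB i : D⁴ ∖ S ↪ P` meeting along `x ∼ gᵢ α x`) along the RADIAL
attaching maps `gᵢ y = (1 - depth(y)/4) · νᵢ (angle y, fibre y)` of tubes `νᵢ` of the components
`Kᵢ` of a framed link `L`, and let `j : P ↪ X` be a smooth embedding into a boundaryless smooth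
`4`-manifold.  Then `Kᵢ` has a slice-disc datum `(e, f)` in `X` (`Knot.IsSliceDiscIn`):

* the ball `e = j ∘ jA ∘ τ`, `τ y = ballContraction (16 y)` (a radial embedding `ℝ⁴ ↪ B̊⁴`, equal to
  `(3/4) ·` on `S³`; `RadialDiffeomorph.lean`, auxiliary file 2);
* the disc `f`: for `‖x‖ < 1/4` the core of the handle read in the handle chart,
  `f x = j (jB i (x, 0))`, and for `‖x‖ ≥ 1/4` the radial cone `f x = j (jA (σ(‖x‖²) · Kᵢ(x/‖x‖)))`
  with the profile `σ` of auxiliary file 1 (`σ(t) = 1 - t/4` on `t ≤ 5/4`).  The two formulas agree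
  on `1/10 < ‖x‖ < 1/4` because Kosinski's inversion `α` preserves `x_μ = 0` and glues the punctured
  core point `(x, 0)` to `gᵢ (√(1-‖x‖²) x/‖x‖, 0) = (1 - ‖x‖²/4) · Kᵢ(x/‖x‖)`
  (`glueRel_cone_lamEmbed`, auxiliary file 2), so `f` is `C^∞`; it is an injective immersion on
  `𝔻²`, its open disc misses `e(𝔻⁴)` (`D⁴`-radii `> 3/4` versus `≤ 3/4`, or the unglued belt-disc
  centre), and `f = e ∘ Kᵢ` on `S¹` (`σ 1 = 3/4 = ballProfile 16`).

The axioms are verified in §1 for abstract data `(h, ν, jA, jB, j, σ, fA, fB, τ, f, e)` pinned down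
by their values in `ℝ⁴` (`isSliceDiscIn_of_coreDiscData`); §2 assembles the datum.

References: R. E. Gompf, M. Scharlemann, A. Thompson, *Fibered knots and potential counterexamples
to the Property 2R and Slice-Ribbon Conjectures*, Geom. Topol. 14 (2010), proof of Prop. 2.3;
R. C. Kirby, *The Topology of 4-Manifolds*, LNM 1374 (1989), Ch. I §2; A. A. Kosinski,
*Differential Manifolds* (1993), VI §6.
-/

noncomputable section

-- the prescribed namespace `Summit.<P>.<Sub>.…` duplicates `SmoothPoincare4` (P = Sub)
set_option linter.dupNamespace false

open scoped Manifold ContDiff Topology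
open Set Function Metric Literature.Topology.FourManifolds

namespace Summit.SmoothPoincare4.SmoothPoincare4.Theorems.VrlComponentsHBallSlice.KirbyLemma21

/-! ## §1 The core disc of a `2`-handle is a slice-disc datum (abstract data) -/

section CoreDisc

variable {K : Knot} (ν : Knot.TubularNbhd ⇑K) {σ : ℝ → ℝ} {P : Type*} {X : Type*}
  {U : TopologicalSpace.Opens (Metric.closedBall (0 : EuclideanSpace ℝ (Fin 4)) 1)}
  {jA : U → P} {jB : ↥(beltPiece 3 2) → P} {j : P → X} {fA : EuclideanSpace ℝ (Fin 2) → U}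
  {fB : EuclideanSpace ℝ (Fin 2) → ↥(beltPiece 3 2)} {τ : EuclideanSpace ℝ (Fin 4) → U}
  {f : EuclideanSpace ℝ (Fin 2) → X} {e : EuclideanSpace ℝ (Fin 4) → X}

/-- **On `1/10 < ‖x‖ < 1/4` the handle-chart core and the radial cone give the same point of `P`**:
`jB (x, 0) = jA (σ(‖x‖²) · K(x/‖x‖))`, `σ(‖x‖²) = 1 - ‖x‖²/4` (Kosinski's gluing along the radial
attaching map, `glueRel_cone_lamEmbed`). [cite: Kosinski1993, VI §6] -/
theorem jB_fB_eq_jA_fA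
    (h : HandleAttachingMap 3 2 (Metric.closedBall (0 : EuclideanSpace ℝ (Fin 4)) 1))
    (hg : ∀ y : ↥(handleTube 3 2), (h.toFun y : EuclideanSpace ℝ (Fin 4)) =
      (1 - tubeDepth y / 4) • (ν (tubeAngle y, tubeFibre y) : EuclideanSpace ℝ (Fin 4)))
    (hglue : ∀ a b, jA a = jB b ↔ h.glueRel a b) (hσeq : ∀ t : ℝ, t ≤ 5 / 4 → σ t = 1 - t / 4)
    (hfA : ∀ x, (fA x : EuclideanSpace ℝ (Fin 4)) =
      ν.coneTube (radialMap (fun r => σ (r ^ 2)) x, 0))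
    (hfB : ∀ x, (fB x : EuclideanSpace ℝ (Fin 4)) = lamEmbed (ballContraction ((32 : ℝ) • x)))
    {x : EuclideanSpace ℝ (Fin 2)} (h1 : 10⁻¹ < ‖x‖) (h2 : ‖x‖ < 4⁻¹) : jB (fB x) = jA (fA x) := by
  symm
  rw [hglue]
  have hx0 : x ≠ 0 := fun h0 => by rw [h0, norm_zero] at h1; norm_num at h1
  have hx1 : ‖x‖ < 1 := h2.trans (by norm_num)
  have ht : ‖x‖ ^ 2 ≤ 5 / 4 := by nlinarith
  have hσx : σ (‖x‖ ^ 2) = 1 - ‖x‖ ^ 2 / 4 := hσeq _ ht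
  have hpos : 0 < σ (‖x‖ ^ 2) := by rw [hσx]; nlinarith
  refine glueRel_cone_lamEmbed h ν hg hx0 hx1 ?_ ?_
  · rw [hfA, coneDisc_eq_smul ν σ hx0 hpos, hσx]
  · rw [hfB, lamEmbed_ballContraction_smul_of_norm_lt h2]

/-- **Off the small disc `‖x‖ ≤ 1/10` the core disc is the radial formula** `f = j ∘ jA ∘ fA`.
[cite: Kosinski1993, VI §6] -/
theorem coreDisc_eq_radial
    (h : HandleAttachingMap 3 2 (Metric.closedBall (0 : EuclideanSpace ℝ (Fin 4)) 1))
    (hg : ∀ y : ↥(handleTube 3 2), (h.toFun y : EuclideanSpace ℝ (Fin 4)) =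
      (1 - tubeDepth y / 4) • (ν (tubeAngle y, tubeFibre y) : EuclideanSpace ℝ (Fin 4)))
    (hglue : ∀ a b, jA a = jB b ↔ h.glueRel a b) (hσeq : ∀ t : ℝ, t ≤ 5 / 4 → σ t = 1 - t / 4)
    (hfA : ∀ x, (fA x : EuclideanSpace ℝ (Fin 4)) =
      ν.coneTube (radialMap (fun r => σ (r ^ 2)) x, 0))
    (hfB : ∀ x, (fB x : EuclideanSpace ℝ (Fin 4)) = lamEmbed (ballContraction ((32 : ℝ) • x)))
    (hf1 : ∀ x, ‖x‖ < 4⁻¹ → f x = j (jB (fB x))) (hf2 : ∀ x, 4⁻¹ ≤ ‖x‖ → f x = j (jA (fA x)))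
    {x : EuclideanSpace ℝ (Fin 2)} (hx : 10⁻¹ < ‖x‖) : f x = j (jA (fA x)) := by
  by_cases h4 : ‖x‖ < 4⁻¹
  · rw [hf1 x h4, jB_fB_eq_jA_fA ν h hg hglue hσeq hfA hfB hx h4]
  · exact hf2 x (not_lt.1 h4)

/-- **The core disc is `C^∞`**: near a point with `‖x‖ < 1/4` it is `j ∘ jB ∘ fB` (handle chart,
smooth), near a point with `‖x‖ ≥ 1/4` it is `j ∘ jA ∘ fA` (radial cone, smooth off the origin).
[cite: GompfScharlemannThompson2010, proof of Prop. 2.3] -/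
theorem contMDiff_coreDisc [TopologicalSpace P] [ChartedSpace (EuclideanHalfSpace 4) P]
    [IsManifold (𝓡∂ 4) ((⊤ : ℕ∞) : WithTop ℕ∞) P] [TopologicalSpace X]
    [ChartedSpace (EuclideanSpace ℝ (Fin 4)) X] [IsManifold (𝓡 4) ((⊤ : ℕ∞) : WithTop ℕ∞) X]
    (h : HandleAttachingMap 3 2 (Metric.closedBall (0 : EuclideanSpace ℝ (Fin 4)) 1))
    (hg : ∀ y : ↥(handleTube 3 2), (h.toFun y : EuclideanSpace ℝ (Fin 4)) =
      (1 - tubeDepth y / 4) • (ν (tubeAngle y, tubeFibre y) : EuclideanSpace ℝ (Fin 4)))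
    (hjA : Manifold.IsSmoothEmbedding (𝓡∂ 4) (𝓡∂ 4) ((⊤ : ℕ∞) : WithTop ℕ∞) jA)
    (hjB : Manifold.IsSmoothEmbedding (𝓡∂ 4) (𝓡∂ 4) ((⊤ : ℕ∞) : WithTop ℕ∞) jB)
    (hglue : ∀ a b, jA a = jB b ↔ h.glueRel a b)
    (hj : Manifold.IsSmoothEmbedding (𝓡∂ 4) (𝓡 4) ((⊤ : ℕ∞) : WithTop ℕ∞) j)
    (hσ : ContDiff ℝ ((⊤ : ℕ∞) : WithTop ℕ∞) σ) (hσeq : ∀ t : ℝ, t ≤ 5 / 4 → σ t = 1 - t / 4)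
    (hσbd : ∀ t : ℝ, 0 < t → 0 < σ t ∧ σ t < 1)
    (hfA : ∀ x, (fA x : EuclideanSpace ℝ (Fin 4)) =
      ν.coneTube (radialMap (fun r => σ (r ^ 2)) x, 0))
    (hfB : ∀ x, (fB x : EuclideanSpace ℝ (Fin 4)) = lamEmbed (ballContraction ((32 : ℝ) • x)))
    (hf1 : ∀ x, ‖x‖ < 4⁻¹ → f x = j (jB (fB x))) (hf2 : ∀ x, 4⁻¹ ≤ ‖x‖ → f x = j (jA (fA x))) :
    ContMDiff (𝓡 2) (𝓡 4) ((⊤ : ℕ∞) : WithTop ℕ∞) f := by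
  intro x
  by_cases hx : ‖x‖ < 4⁻¹
  · have hev : f =ᶠ[𝓝 x] fun y => j (jB (fB y)) :=
      Filter.eventuallyEq_of_mem ((isOpen_lt continuous_norm continuous_const).mem_nhds hx)
        fun y hy => hf1 y hy
    exact (contMDiffAt_comp_opensBall hjB.contMDiff hj.contMDiff hfB
      contDiff_lamEmbed_ballContraction.contDiffAt.contMDiffAt).congr_of_eventuallyEq hev
  · have hx' : 10⁻¹ < ‖x‖ := lt_of_lt_of_le (by norm_num) (not_lt.1 hx)
    have hev : f =ᶠ[𝓝 x] fun y => j (jA (fA y)) :=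
      Filter.eventuallyEq_of_mem ((isOpen_lt continuous_const continuous_norm).mem_nhds hx')
        fun y hy => coreDisc_eq_radial ν h hg hglue hσeq hfA hfB hf1 hf2 hy
    have hx0 : x ≠ 0 := fun h0 => by rw [h0, norm_zero] at hx'; norm_num at hx'
    exact (contMDiffAt_comp_opensBall hjA.contMDiff hj.contMDiff hfA
      (contDiffAt_coneDisc ν σ hx0 hσ.contDiffAt
        (hσbd _ (by positivity)).1.ne').contMDiffAt).congr_of_eventuallyEq hev

/-- **The core disc is an immersion on `𝔻²`**: the handle chart is immersive
(`injective_mfderiv_lamEmbed_ballContraction`), the radial cone is immersive for `‖x‖ ≤ 1` since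
there `σ(t) = 1 - t/4` has `σ' = -1/4 ≠ 0` (`injective_fderiv_coneDisc`), and `jA`, `jB`, `j` are
smooth embeddings. [cite: GompfScharlemannThompson2010, proof of Prop. 2.3] -/
theorem injective_mfderiv_coreDisc [TopologicalSpace P] [ChartedSpace (EuclideanHalfSpace 4) P]
    [IsManifold (𝓡∂ 4) ((⊤ : ℕ∞) : WithTop ℕ∞) P] [TopologicalSpace X]
    [ChartedSpace (EuclideanSpace ℝ (Fin 4)) X] [IsManifold (𝓡 4) ((⊤ : ℕ∞) : WithTop ℕ∞) X]
    (h : HandleAttachingMap 3 2 (Metric.closedBall (0 : EuclideanSpace ℝ (Fin 4)) 1))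
    (hg : ∀ y : ↥(handleTube 3 2), (h.toFun y : EuclideanSpace ℝ (Fin 4)) =
      (1 - tubeDepth y / 4) • (ν (tubeAngle y, tubeFibre y) : EuclideanSpace ℝ (Fin 4)))
    (hjA : Manifold.IsSmoothEmbedding (𝓡∂ 4) (𝓡∂ 4) ((⊤ : ℕ∞) : WithTop ℕ∞) jA)
    (hjB : Manifold.IsSmoothEmbedding (𝓡∂ 4) (𝓡∂ 4) ((⊤ : ℕ∞) : WithTop ℕ∞) jB)
    (hglue : ∀ a b, jA a = jB b ↔ h.glueRel a b)
    (hj : Manifold.IsSmoothEmbedding (𝓡∂ 4) (𝓡 4) ((⊤ : ℕ∞) : WithTop ℕ∞) j)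
    (hσ : ContDiff ℝ ((⊤ : ℕ∞) : WithTop ℕ∞) σ) (hσeq : ∀ t : ℝ, t ≤ 5 / 4 → σ t = 1 - t / 4)
    (hfA : ∀ x, (fA x : EuclideanSpace ℝ (Fin 4)) =
      ν.coneTube (radialMap (fun r => σ (r ^ 2)) x, 0))
    (hfB : ∀ x, (fB x : EuclideanSpace ℝ (Fin 4)) = lamEmbed (ballContraction ((32 : ℝ) • x)))
    (hf1 : ∀ x, ‖x‖ < 4⁻¹ → f x = j (jB (fB x))) (hf2 : ∀ x, 4⁻¹ ≤ ‖x‖ → f x = j (jA (fA x)))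
    {x : EuclideanSpace ℝ (Fin 2)} (hx1 : ‖x‖ ≤ 1) : Injective (mfderiv (𝓡 2) (𝓡 4) f x) := by
  by_cases hx : ‖x‖ < 4⁻¹
  · have hev : f =ᶠ[𝓝 x] fun y => j (jB (fB y)) :=
      Filter.eventuallyEq_of_mem ((isOpen_lt continuous_norm continuous_const).mem_nhds hx)
        fun y hy => hf1 y hy
    rw [hev.mfderiv_eq]
    exact injective_mfderiv_comp_opensBall hjB hj hfB
      contDiff_lamEmbed_ballContraction.contDiffAt.contMDiffAt
      (injective_mfderiv_lamEmbed_ballContraction hx)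
  · have hx' : 10⁻¹ < ‖x‖ := lt_of_lt_of_le (by norm_num) (not_lt.1 hx)
    have hev : f =ᶠ[𝓝 x] fun y => j (jA (fA y)) :=
      Filter.eventuallyEq_of_mem ((isOpen_lt continuous_const continuous_norm).mem_nhds hx')
        fun y hy => coreDisc_eq_radial ν h hg hglue hσeq hfA hfB hf1 hf2 hy
    rw [hev.mfderiv_eq]
    have hx0 : x ≠ 0 := fun h0 => by rw [h0, norm_zero] at hx'; norm_num at hx'
    have hlt : ‖x‖ ^ 2 < 5 / 4 := by nlinarith
    have h0 : σ (‖x‖ ^ 2) ≠ 0 := by rw [hσeq _ hlt.le]; nlinarith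
    have hev' : σ =ᶠ[𝓝 (‖x‖ ^ 2)] fun t => 1 - t / 4 :=
      Filter.eventuallyEq_of_mem (Iio_mem_nhds hlt) fun t ht => hσeq t (le_of_lt ht)
    have hσ' : HasDerivAt σ (-(1 / 4)) (‖x‖ ^ 2) :=
      HasDerivAt.congr_of_eventuallyEq (((hasDerivAt_id (‖x‖ ^ 2)).div_const 4).const_sub 1) hev'
    refine injective_mfderiv_comp_opensBall hjA hj hfA
      (contDiffAt_coneDisc ν σ hx0 hσ.contDiffAt h0).contMDiffAt ?_
    rw [mfderiv_eq_fderiv]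
    exact injective_fderiv_coneDisc ν σ hx0 hσ.contDiffAt hσ' h0 (by norm_num)

/-- **The core disc is injective on `𝔻²`**: two handle-chart points — `jB`, `j` injective and
`(x, 0) = (x', 0)`; two radial points — the cone is injective (`eq_of_coneDisc_eq`, `σ` strictly
decreasing on `[0, 5/4]`); a handle-chart point is never a radial point, their `D⁴`-radii being
`> 1 - 1/64` and `≤ 1 - 1/64` (`norm_of_jA_eq_jB`).
[cite: GompfScharlemannThompson2010, proof of Prop. 2.3] -/
theorem injOn_coreDisc
    (h : HandleAttachingMap 3 2 (Metric.closedBall (0 : EuclideanSpace ℝ (Fin 4)) 1))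
    (hg : ∀ y : ↥(handleTube 3 2), (h.toFun y : EuclideanSpace ℝ (Fin 4)) =
      (1 - tubeDepth y / 4) • (ν (tubeAngle y, tubeFibre y) : EuclideanSpace ℝ (Fin 4)))
    (hjA : Injective jA) (hjB : Injective jB) (hglue : ∀ a b, jA a = jB b ↔ h.glueRel a b)
    (hj : Injective j) (hσeq : ∀ t : ℝ, t ≤ 5 / 4 → σ t = 1 - t / 4)
    (hfA : ∀ x, (fA x : EuclideanSpace ℝ (Fin 4)) =
      ν.coneTube (radialMap (fun r => σ (r ^ 2)) x, 0))
    (hfB : ∀ x, (fB x : EuclideanSpace ℝ (Fin 4)) = lamEmbed (ballContraction ((32 : ℝ) • x)))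
    (hf1 : ∀ x, ‖x‖ < 4⁻¹ → f x = j (jB (fB x))) (hf2 : ∀ x, 4⁻¹ ≤ ‖x‖ → f x = j (jA (fA x))) :
    InjOn f (Metric.closedBall (0 : EuclideanSpace ℝ (Fin 2)) 1) := by
  -- the radial values have `σ(‖x‖²) = 1 - ‖x‖²/4`
  have hσx : ∀ x : EuclideanSpace ℝ (Fin 2), ‖x‖ ≤ 1 → σ (‖x‖ ^ 2) = 1 - ‖x‖ ^ 2 / 4 :=
    fun x hx => hσeq _ (by nlinarith [norm_nonneg x])
  have hnA : ∀ x : EuclideanSpace ℝ (Fin 2), x ≠ 0 → ‖x‖ ≤ 1 →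
      ‖(fA x : EuclideanSpace ℝ (Fin 4))‖ = 1 - ‖x‖ ^ 2 / 4 := by
    intro x hx0 hx
    rw [hfA, norm_coneDisc ν σ hx0, hσx x hx, abs_of_pos (by nlinarith [norm_nonneg x])]
  -- mixed case
  have hmixed : ∀ x x' : EuclideanSpace ℝ (Fin 2), ‖x‖ < 4⁻¹ → 4⁻¹ ≤ ‖x'‖ → ‖x'‖ ≤ 1 →
      f x ≠ f x' := by
    intro x x' hx hx' hx'1 hxx
    rw [hf1 x hx, hf2 x' hx'] at hxx
    have hx'0 : x' ≠ 0 := fun h0 => by rw [h0, norm_zero] at hx'; norm_num at hx'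
    obtain ⟨-, hn⟩ := norm_of_jA_eq_jB h ν hg hglue hfB hx (hj hxx).symm
    rw [hnA x' hx'0 hx'1] at hn
    nlinarith [norm_nonneg x, norm_nonneg x']
  intro x hx x' hx' hxx
  rw [mem_closedBall_zero_iff] at hx hx'
  by_cases h1 : ‖x‖ < 4⁻¹ <;> by_cases h2 : ‖x'‖ < 4⁻¹
  · rw [hf1 x h1, hf1 x' h2] at hxx
    have h3 := congrArg (fun b : ↥(beltPiece 3 2) => (b : EuclideanSpace ℝ (Fin 4))) (hjB (hj hxx))
    simp only [hfB, lamEmbed_ballContraction_smul_of_norm_lt h1,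
      lamEmbed_ballContraction_smul_of_norm_lt h2] at h3
    simpa using congrArg lamPart h3
  · exact absurd hxx (hmixed x x' h1 (not_lt.1 h2) hx')
  · exact absurd hxx.symm (hmixed x' x h2 (not_lt.1 h1) hx)
  · rw [hf2 x (not_lt.1 h1), hf2 x' (not_lt.1 h2)] at hxx
    have hx0 : x ≠ 0 := fun h0 => by rw [h0, norm_zero] at h1; norm_num at h1
    have hx'0 : x' ≠ 0 := fun h0 => by rw [h0, norm_zero] at h2; norm_num at h2
    have h3 := congrArg (fun a : U => (a : EuclideanSpace ℝ (Fin 4))) (hjA (hj hxx))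
    simp only [hfA] at h3
    refine eq_of_coneDisc_eq ν σ hx0 hx'0 (by rw [hσx x hx]; nlinarith)
      (by rw [hσx x' hx']; nlinarith) h3 fun hs => ?_
    rw [hσx x hx, hσx x' hx'] at hs
    have hsq : ‖x‖ ^ 2 = ‖x'‖ ^ 2 := by linarith
    exact (sq_eq_sq₀ (norm_nonneg x) (norm_nonneg x')).1 hsq

/-- **Properness: the open core disc misses the shrunken `0`-handle `e(𝔻⁴) = j (jA (τ 𝔻⁴))`**,
whose points have `D⁴`-radius `≤ 3/4` (`norm_ballContraction_smul_le`): a radial point of the open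
disc has radius `σ(‖x‖²) = 1 - ‖x‖²/4 > 3/4`, and a handle-chart point is glued only to a point of
radius `1 - ‖x‖²/4 > 3/4` (`norm_of_jA_eq_jB`).
[cite: GompfScharlemannThompson2010, proof of Prop. 2.3] -/
theorem coreDisc_notMem
    (h : HandleAttachingMap 3 2 (Metric.closedBall (0 : EuclideanSpace ℝ (Fin 4)) 1))
    (hg : ∀ y : ↥(handleTube 3 2), (h.toFun y : EuclideanSpace ℝ (Fin 4)) =
      (1 - tubeDepth y / 4) • (ν (tubeAngle y, tubeFibre y) : EuclideanSpace ℝ (Fin 4)))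
    (hjA : Injective jA) (hglue : ∀ a b, jA a = jB b ↔ h.glueRel a b) (hj : Injective j)
    (hσeq : ∀ t : ℝ, t ≤ 5 / 4 → σ t = 1 - t / 4)
    (hfA : ∀ x, (fA x : EuclideanSpace ℝ (Fin 4)) =
      ν.coneTube (radialMap (fun r => σ (r ^ 2)) x, 0))
    (hfB : ∀ x, (fB x : EuclideanSpace ℝ (Fin 4)) = lamEmbed (ballContraction ((32 : ℝ) • x)))
    (hτ : ∀ y, (τ y : EuclideanSpace ℝ (Fin 4)) = ballContraction ((16 : ℝ) • y))
    (hf1 : ∀ x, ‖x‖ < 4⁻¹ → f x = j (jB (fB x))) (hf2 : ∀ x, 4⁻¹ ≤ ‖x‖ → f x = j (jA (fA x)))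
    (he : ∀ y, e y = j (jA (τ y))) {x : EuclideanSpace ℝ (Fin 2)} (hx : ‖x‖ < 1) :
    f x ∉ e '' Metric.closedBall (0 : EuclideanSpace ℝ (Fin 4)) 1 := by
  rintro ⟨y, hy, hxy⟩
  rw [mem_closedBall_zero_iff] at hy
  rw [he] at hxy
  have hτy : ‖(τ y : EuclideanSpace ℝ (Fin 4))‖ ≤ 3 / 4 := by
    rw [hτ]; exact norm_ballContraction_smul_le hy
  by_cases h1 : ‖x‖ < 4⁻¹
  · rw [hf1 x h1] at hxy
    obtain ⟨-, hn⟩ := norm_of_jA_eq_jB h ν hg hglue hfB h1 (hj hxy)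
    rw [hn] at hτy
    nlinarith [norm_nonneg x]
  · rw [hf2 x (not_lt.1 h1)] at hxy
    have hx0 : x ≠ 0 := fun h0 => by rw [h0, norm_zero] at h1; norm_num at h1
    have heq : τ y = fA x := hjA (hj hxy)
    have hn : ‖(fA x : EuclideanSpace ℝ (Fin 4))‖ = 1 - ‖x‖ ^ 2 / 4 := by
      rw [hfA, norm_coneDisc ν σ hx0, hσeq _ (by nlinarith), abs_of_pos (by nlinarith)]
    rw [heq, hn] at hτy
    nlinarith [norm_nonneg x]

/-- **Boundary values: `f = e ∘ K` on `S¹`**: `f u = j (jA (σ 1 · K u))` with `σ 1 = 3/4`, and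
`e (K u) = j (jA (ballContraction (16 K u))) = j (jA ((3/4) · K u))` (`ballProfile 16 = 3/4`).
[cite: GompfScharlemannThompson2010, proof of Prop. 2.3] -/
theorem coreDisc_coe_sphere (hσeq : ∀ t : ℝ, t ≤ 5 / 4 → σ t = 1 - t / 4)
    (hfA : ∀ x, (fA x : EuclideanSpace ℝ (Fin 4)) =
      ν.coneTube (radialMap (fun r => σ (r ^ 2)) x, 0))
    (hτ : ∀ y, (τ y : EuclideanSpace ℝ (Fin 4)) = ballContraction ((16 : ℝ) • y))
    (hf2 : ∀ x, 4⁻¹ ≤ ‖x‖ → f x = j (jA (fA x))) (he : ∀ y, e y = j (jA (τ y)))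
    (u : Metric.sphere (0 : EuclideanSpace ℝ (Fin 2)) 1) : f u = e (K u) := by
  have hu : ‖(u : EuclideanSpace ℝ (Fin 2))‖ = 1 := norm_eq_of_mem_sphere u
  have hσ1 : σ 1 = 3 / 4 := by rw [hσeq 1 (by norm_num)]; norm_num
  rw [hf2 _ (by rw [hu]; norm_num), he]
  congr 2
  apply Subtype.ext
  apply Subtype.ext
  show (fA u : EuclideanSpace ℝ (Fin 4)) = (τ (K u) : EuclideanSpace ℝ (Fin 4))
  rw [hfA, hτ, coneDisc_coe_sphere ν σ u (by rw [hσ1]; norm_num), hσ1,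
    ballContraction_smul_coe_sphere]

/-- **The core of the `2`-handle is a slice-disc datum** (abstract form of stub 4): for the radial
attaching map `h` of a tube `ν` of `K`, smooth embeddings `jA : U ↪ P` (`U ⊆ D⁴` open),
`jB : D⁴ ∖ S ↪ P` meeting along Kosinski's relation, `j : P ↪ X` into a boundaryless `4`-manifold,
the profile `σ`, and maps `fA`, `fB`, `τ`, `f`, `e` with the prescribed values,
`K.IsSliceDiscIn X e f`: `e` is a smoothly embedded ball (`isSmoothEmbedding_ballChart`) and `f` a
`C^∞` map, an injective immersion on `𝔻²` whose open disc misses `e(𝔻⁴)`, with `f = e ∘ K` on `S¹`.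
[cite: GompfScharlemannThompson2010, proof of Prop. 2.3] -/
theorem isSliceDiscIn_of_coreDiscData [TopologicalSpace P] [ChartedSpace (EuclideanHalfSpace 4) P]
    [IsManifold (𝓡∂ 4) ((⊤ : ℕ∞) : WithTop ℕ∞) P] [TopologicalSpace X]
    [ChartedSpace (EuclideanSpace ℝ (Fin 4)) X] [IsManifold (𝓡 4) ((⊤ : ℕ∞) : WithTop ℕ∞) X]
    (h : HandleAttachingMap 3 2 (Metric.closedBall (0 : EuclideanSpace ℝ (Fin 4)) 1))
    (hg : ∀ y : ↥(handleTube 3 2), (h.toFun y : EuclideanSpace ℝ (Fin 4)) =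
      (1 - tubeDepth y / 4) • (ν (tubeAngle y, tubeFibre y) : EuclideanSpace ℝ (Fin 4)))
    (hjA : Manifold.IsSmoothEmbedding (𝓡∂ 4) (𝓡∂ 4) ((⊤ : ℕ∞) : WithTop ℕ∞) jA)
    (hjB : Manifold.IsSmoothEmbedding (𝓡∂ 4) (𝓡∂ 4) ((⊤ : ℕ∞) : WithTop ℕ∞) jB)
    (hglue : ∀ a b, jA a = jB b ↔ h.glueRel a b)
    (hj : Manifold.IsSmoothEmbedding (𝓡∂ 4) (𝓡 4) ((⊤ : ℕ∞) : WithTop ℕ∞) j)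
    (hσ : ContDiff ℝ ((⊤ : ℕ∞) : WithTop ℕ∞) σ) (hσeq : ∀ t : ℝ, t ≤ 5 / 4 → σ t = 1 - t / 4)
    (hσbd : ∀ t : ℝ, 0 < t → 0 < σ t ∧ σ t < 1)
    (hfA : ∀ x, (fA x : EuclideanSpace ℝ (Fin 4)) =
      ν.coneTube (radialMap (fun r => σ (r ^ 2)) x, 0))
    (hfB : ∀ x, (fB x : EuclideanSpace ℝ (Fin 4)) = lamEmbed (ballContraction ((32 : ℝ) • x)))
    (hτ : ∀ y, (τ y : EuclideanSpace ℝ (Fin 4)) = ballContraction ((16 : ℝ) • y))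
    (hf1 : ∀ x, ‖x‖ < 4⁻¹ → f x = j (jB (fB x))) (hf2 : ∀ x, 4⁻¹ ≤ ‖x‖ → f x = j (jA (fA x)))
    (he : ∀ y, e y = j (jA (τ y))) : K.IsSliceDiscIn X e f := by
  have hjAi : Injective jA := hjA.isEmbedding.injective
  have hjBi : Injective jB := hjB.isEmbedding.injective
  have hji : Injective j := hj.isEmbedding.injective
  exact ⟨isSmoothEmbedding_ballChart hjA hj hτ he,
    contMDiff_coreDisc ν h hg hjA hjB hglue hj hσ hσeq hσbd hfA hfB hf1 hf2,
    injOn_coreDisc ν h hg hjAi hjBi hglue hji hσeq hfA hfB hf1 hf2,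
    fun x hx => injective_mfderiv_coreDisc ν h hg hjA hjB hglue hj hσ hσeq hfA hfB hf1 hf2
      (mem_closedBall_zero_iff.1 hx),
    fun x hx => coreDisc_notMem ν h hg hjAi hglue hji hσeq hfA hfB hτ hf1 hf2 he hx,
    coreDisc_coe_sphere ν hσeq hfA hτ hf2 he⟩

end CoreDisc

/-! ## §2 The registered stub -/

/-- **Stub 4 of line `kirby-lemma21` — in `D⁴ ∪ (2-handles)` every component bounds the core of its
`2`-handle, off a shrunken `0`-handle** (`stub_core_isSliceDiscIn_of_isMultiAttachment`, registered
signature verbatim).  With the `2`-handles attached to `D⁴` along the radial attaching maps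
`gᵢ y = (1 - depth(y)/4) · νᵢ (angle y, fibre y)` of tubes of the components of `L`
(`HandleAttachingMap.IsMultiAttachment g (𝓡∂ 4) P`) and `j : P ↪ X` a smooth embedding into a
boundaryless smooth `4`-manifold, every component `L.component i` has a slice-disc datum
`(e, f)` in `X`: `e = j ∘ jA ∘ (y ↦ ballContraction (16 y))` and `f` the core of the `i`-th handle,
`j (jB i (ballContraction (32 x), 0))` for `‖x‖ < 1/4` continued by the radial cone
`j (jA (σ(‖x‖²) · Kᵢ(x/‖x‖)))` (`isSliceDiscIn_of_coreDiscData`).  Gompf–Scharlemann–Thompson,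
proof of Prop. 2.3: "the cores of the original `n` `2`-handles … are the required `n` `2`-disks".
[cite: GompfScharlemannThompson2010, proof of Prop. 2.3] [cite: Kosinski1993, VI §6] -/
theorem stub_core_isSliceDiscIn_of_isMultiAttachment :
    ∀ (n : ℕ) (L : FramedLink (Fin n))
      (g : Fin n → HandleAttachingMap 3 2 (Metric.closedBall (0 : EuclideanSpace ℝ (Fin 4)) 1))
      (ν : ∀ i, Knot.TubularNbhd ⇑(L.component i)),
      (∀ (i : Fin n) (y : ↥(handleTube 3 2)),
        (((g i).toFun y : Metric.closedBall (0 : EuclideanSpace ℝ (Fin 4)) 1) : EuclideanSpace ℝ (Fin 4)) =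
          (1 - tubeDepth y / 4) •
            ((ν i (tubeAngle y, tubeFibre y) : Metric.sphere (0 : EuclideanSpace ℝ (Fin 4)) 1) :
              EuclideanSpace ℝ (Fin 4))) →
      ∀ (P : Type) [TopologicalSpace P] [T2Space P] [ChartedSpace (EuclideanHalfSpace 4) P]
        [IsManifold (𝓡∂ 4) ((⊤ : ℕ∞) : WithTop ℕ∞) P],
        HandleAttachingMap.IsMultiAttachment g (𝓡∂ 4) P →
        ∀ (X : Type) [TopologicalSpace X] [T2Space X] [ChartedSpace (EuclideanSpace ℝ (Fin 4)) X]
          [IsManifold (𝓡 4) ((⊤ : ℕ∞) : WithTop ℕ∞) X] (j : P → X),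
          Manifold.IsSmoothEmbedding (𝓡∂ 4) (𝓡 4) ((⊤ : ℕ∞) : WithTop ℕ∞) j →
          ∀ i : Fin n, ∃ (e : EuclideanSpace ℝ (Fin 4) → X) (f : EuclideanSpace ℝ (Fin 2) → X),
            (L.component i).IsSliceDiscIn X e f := by
  intro n L g ν hg P _ _ _ _ hP X _ _ _ _ j hj i
  obtain ⟨-, jA, jB, hjA, -, hjB, -, hglue, -⟩ := hP
  obtain ⟨σ, hσ, hσeq, hσbd⟩ := helper_exists_discProfile
  have hσabs : ∀ t : ℝ, 0 < t → |σ t| < 1 := fun t ht => by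
    rw [abs_of_pos (hσbd t ht).1]; exact (hσbd t ht).2
  -- the radial cone over `Kᵢ`, into `D⁴ ∖ ⋃ cores`
  have hA1 : ∀ x : EuclideanSpace ℝ (Fin 2),
      (ν i).coneTube (radialMap (fun r => σ (r ^ 2)) x, 0) ∈
        Metric.closedBall (0 : EuclideanSpace ℝ (Fin 4)) 1 := fun x =>
    mem_closedBall_zero_iff.2 (norm_coneDisc_lt_one (ν i) σ hσabs x).le
  have hA2 : ∀ x : EuclideanSpace ℝ (Fin 2),
      (⟨_, hA1 x⟩ : Metric.closedBall (0 : EuclideanSpace ℝ (Fin 4)) 1) ∈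
        HandleAttachingMap.coresComplement g := fun x =>
    helper_mem_coresComplement_of_norm_lt_one n g _ (norm_coneDisc_lt_one (ν i) σ hσabs x)
  -- the core of the handle in the handle chart, into `D⁴ ∖ S`
  have hB1 : ∀ x : EuclideanSpace ℝ (Fin 2), lamEmbed (ballContraction ((32 : ℝ) • x)) ∈
      Metric.closedBall (0 : EuclideanSpace ℝ (Fin 4)) 1 := fun x =>
    mem_closedBall_zero_iff.2 (norm_lamEmbed_ballContraction_lt_one x).le
  have hB2 : ∀ x : EuclideanSpace ℝ (Fin 2),
      (⟨_, hB1 x⟩ : Metric.closedBall (0 : EuclideanSpace ℝ (Fin 4)) 1) ∈ beltPiece 3 2 :=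
    fun x => (mem_beltPiece 3 2).2 (lamSq_lamEmbed_ballContraction_ne_one x)
  -- the shrunken `0`-handle chart, into `D⁴ ∖ ⋃ cores`
  have hT1 : ∀ y : EuclideanSpace ℝ (Fin 4), ballContraction ((16 : ℝ) • y) ∈
      Metric.closedBall (0 : EuclideanSpace ℝ (Fin 4)) 1 := fun y =>
    mem_closedBall_zero_iff.2 (norm_ballContraction_lt_one _).le
  have hT2 : ∀ y : EuclideanSpace ℝ (Fin 4),
      (⟨_, hT1 y⟩ : Metric.closedBall (0 : EuclideanSpace ℝ (Fin 4)) 1) ∈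
        HandleAttachingMap.coresComplement g := fun y =>
    helper_mem_coresComplement_of_norm_lt_one n g _ (norm_ballContraction_lt_one _)
  refine ⟨fun y => j (jA ⟨⟨_, hT1 y⟩, hT2 y⟩),
    fun x => if ‖x‖ < 4⁻¹ then j (jB i ⟨⟨_, hB1 x⟩, hB2 x⟩) else j (jA ⟨⟨_, hA1 x⟩, hA2 x⟩), ?_⟩
  exact isSliceDiscIn_of_coreDiscData (ν i) (g i) (hg i) hjA (hjB i).1 (hglue i) hj hσ hσeq hσbd
    (fA := fun x => ⟨⟨_, hA1 x⟩, hA2 x⟩) (fun x => rfl) (fB := fun x => ⟨⟨_, hB1 x⟩, hB2 x⟩)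
    (fun x => rfl) (τ := fun y => ⟨⟨_, hT1 y⟩, hT2 y⟩) (fun y => rfl) (fun x hx => if_pos hx)
    (fun x hx => if_neg (not_lt.2 hx)) (fun y => rfl)

end Summit.SmoothPoincare4.SmoothPoincare4.Theorems.VrlComponentsHBallSlice.KirbyLemma21

end
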